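import Summits.ResolutionOfSingularities.ResolutionOfSingularities.Theorems.FrobeniusLadderFInjectiveMacaulayficationCICertificates
import HarnessLib

/-!
# The CI-chart engine WITHOUT `hunit`: prime-form twins of `span_le_ker_and_sat` → `nonempty_localization_ringEquiv` → `…_quotientChart` →
# `chartClause_of_quotientChartClause` → `ciCertificates`
# (crux `FInjectiveMacaulayfication` stmt-ResolutionOfSingularities-15315, chain w45a; res-L1-w45a-plan-1 R21.5 (2) Q8c / stub-1 «Q8d» interface repair l.≈82430; seat
# res-L1-w45a-stub-1 g12; the originals: res-L1-w45a-stub-1 `CIChartPresentationLocal` ✓ p503677, `…Bridge` ✓ p504623, res-L1-w45a-stub-6 `CIConeFiModel`, `CICertificates` ✓ p507818)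

[OURS · L1 W4.5a] Support file (`--supports stmt-ResolutionOfSingularities-15315 --as helper`); def-free; UNCONDITIONAL; no named fact; zero new mathematics — each theorem is the
original's proof with ONE call swapped. AI-written (AI review is weaker than expert review).

WHY. The engine's binder `hunit : ∃ N r', N • m = Σ_j d_j • a_j + r'` («the chart vertex `x^m` absorbs the monomial `Y^d` factored out of `θ F`») unwinds, with `hgen`, to
`supp u₀ ⊆ supp m` (`u₀` the Newton vertex of `F` exposed by the chart); it FAILS on legitimate unimodular charts of legitimate covers (e.g. `n = 2`, `𝔪·(x²,y²)`, chart
`cone((1,1),(1,2))`, `f = y² + x⁵`: `m = x³`, `u₀ = y²`). It is used at exactly one point — `span_le_ker_and_sat` invokes `CIChartPresentationKernel.psi_eq_zero_of_theta_eq`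
(«`Ψ(Y^d)` is a unit») — and the same kernel file proves the PRIME form `psi_eq_zero_of_theta_eq_of_isPrime` («`(F)` prime and no `x̄_j = 0` ⇒ `R[1/u]` is a domain and
`Ψ(Y^d) ≠ 0`»), whose hypotheses `hprime`, `hXne` the top engine `ciCertificates` ALREADY carries. Hence:
* `CIChartPresentationLocal.span_le_ker_and_sat_of_isPrime`, `CIChartPresentationLocal.nonempty_localization_ringEquiv_of_isPrime`,
* `CIChartPresentationBridge.nonempty_localization_ringEquiv_quotientChart_of_isPrime`,
* `CIConeFiModel.chartClause_of_quotientChartClause_of_isPrime`,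
* ★ `CICertificates.ciCertificates_of_isPrime` — `ciCertificates` VERBATIM minus the `hunit` binder.
Consumer: `FHalfRowOfNewtonNondegenerate.fHalfRow_of_newtonNondegenerate'` (the tame-rung class row consuming exactly the toric-cover data of FACT-LIST F-108 «F-TC»).
[folklore; cite: StacksProject, Tag 0804; Fedder1983, Thm. 1.12 (context)]
-/

-- single-problem summit: the doubled namespace component is forced
set_option linter.dupNamespace false

noncomputable section

open MvPolynomial IsLocalRing RingTheory.Sequence Literature.RingTheory.TightClosure Literature.AlgebraicGeometry.Resolution AlgebraicGeometry CategoryTheory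

namespace Summit.ResolutionOfSingularities.ResolutionOfSingularities.Theorems.FInjectiveMacaulayfication

/-! ## §1 `CIChartPresentationLocal` twins -/

namespace CIChartPresentationLocal

section Chart

variable {n : ℕ} {k : Type} [Field k] (V : Matrix (Fin n) (Fin n) ℕ)
  (hV : IsUnit (V.map (Nat.cast : ℕ → ℤ)).det) (m : Fin n →₀ ℕ) (a : Fin n → (Fin n →₀ ℕ))
  (hgen : ∀ i : Fin n, (Finsupp.equivFunOnFinite.symm (V.mulVec ⇑(a i)) : Fin n →₀ ℕ) =
    Finsupp.equivFunOnFinite.symm (V.mulVec ⇑m) + Finsupp.single i 1)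
  (A : Finset (Fin n →₀ ℕ)) (haA : ∀ i, a i ∈ A)
  (hge : ∀ e ∈ A, (Finsupp.equivFunOnFinite.symm (V.mulVec ⇑m) : Fin n →₀ ℕ) ≤
    Finsupp.equivFunOnFinite.symm (V.mulVec ⇑e))
  {c : ℕ} (Fs gs : Fin c → MvPolynomial (Fin n) k) (d : Fin c → (Fin n →₀ ℕ))
  (hθF : ∀ i : Fin c, aeval (fun j : Fin n => ∏ l : Fin n, (X l : MvPolynomial (Fin n) k) ^ V l j) (Fs i) =
    monomial (d i) (1 : k) * gs i)

include hV hgen hθF in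
/-- **The kernel sandwich, prime form** (`(F)` prime, no `x̄_j = 0`; NO `hunit`): `(g₁, …, g_c) ⊆ ker φ ⊆ ((g) : Y^∞)` via
`CIChartPresentationKernel.psi_eq_zero_of_theta_eq_of_isPrime`. [folklore] -/
theorem span_le_ker_and_sat_of_isPrime (hprime : (Ideal.span (Set.range Fs)).IsPrime) (hXne : ∀ j : Fin n, Ideal.Quotient.mk (Ideal.span (Set.range Fs)) (X j) ≠ 0)
    {B' : Type} [CommRing B'] (φ : MvPolynomial (Fin n) k →+* B')
    (hker : ∀ h : MvPolynomial (Fin n) k, h ∈ RingHom.ker φ ↔ aeval (fun i : Fin n => algebraMap (MvPolynomial (Fin n) k ⧸ Ideal.span (Set.range Fs))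
          (Localization.Away (Ideal.Quotient.mk (Ideal.span (Set.range Fs)) (monomial m (1 : k))))
          (Ideal.Quotient.mk (Ideal.span (Set.range Fs)) (monomial (a i) (1 : k))) *
          IsLocalization.Away.invSelf (Ideal.Quotient.mk (Ideal.span (Set.range Fs)) (monomial m (1 : k)))) h = 0) :
    Ideal.span (Set.range gs) ≤ RingHom.ker φ ∧
      ∀ h ∈ RingHom.ker φ, ∃ e : Fin n →₀ ℕ, monomial e (1 : k) * h ∈ Ideal.span (Set.range gs) := by
  have hmapF : (Ideal.span (Set.range Fs)).map
      (aeval (fun j : Fin n => ∏ l : Fin n, (X l : MvPolynomial (Fin n) k) ^ V l j)).toRingHom ≤ Ideal.span (Set.range gs) := by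
    rw [Ideal.map_span, Ideal.span_le]
    rintro _ ⟨_, ⟨i, rfl⟩, rfl⟩
    change aeval (fun j : Fin n => ∏ l : Fin n, (X l : MvPolynomial (Fin n) k) ^ V l j) (Fs i) ∈ Ideal.span (Set.range gs)
    rw [hθF i]
    exact Ideal.mul_mem_left _ _ (Ideal.subset_span ⟨i, rfl⟩)
  refine ⟨?_, fun h hh => ?_⟩
  · rw [Ideal.span_le]
    rintro _ ⟨i, rfl⟩
    rw [SetLike.mem_coe, hker]
    exact CIChartPresentationKernel.psi_eq_zero_of_theta_eq_of_isPrime (Ideal.span (Set.range Fs)) V hV m a hgen hprime hXne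
      (Ideal.subset_span ⟨i, rfl⟩) (hθF i)
  · obtain ⟨e, he⟩ := CIChartPresentationKernel.exists_monomial_mul_mem_map_of_psi_eq_zero (Ideal.span (Set.range Fs)) V m a
      hgen h ((hker h).mp hh)
    exact ⟨e, hmapF he⟩

include hV hgen hθF in
/-- **The local presentation of the strict transform, prime form** (NO `hunit`). [folklore] -/
theorem nonempty_localization_ringEquiv_of_isPrime (hprime : (Ideal.span (Set.range Fs)).IsPrime) (hXne : ∀ j : Fin n, Ideal.Quotient.mk (Ideal.span (Set.range Fs)) (X j) ≠ 0)
    (φ : MvPolynomial (Fin n) k →+* ↥(blowupAlgebra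
          (Ideal.span ((fun e : Fin n →₀ ℕ => Ideal.Quotient.mk (Ideal.span (Set.range Fs)) (monomial e (1 : k))) '' (A : Set _)))
          (Ideal.Quotient.mk (Ideal.span (Set.range Fs)) (monomial m (1 : k)))))
    (hsurj : Function.Surjective φ) (hφ : ∀ q : MvPolynomial (Fin n) k, (φ q).val = aeval (fun i : Fin n => algebraMap (MvPolynomial (Fin n) k ⧸ Ideal.span (Set.range Fs))
          (Localization.Away (Ideal.Quotient.mk (Ideal.span (Set.range Fs)) (monomial m (1 : k))))
          (Ideal.Quotient.mk (Ideal.span (Set.range Fs)) (monomial (a i) (1 : k))) *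
          IsLocalization.Away.invSelf (Ideal.Quotient.mk (Ideal.span (Set.range Fs)) (monomial m (1 : k)))) q)
    (Q : Ideal ↥(blowupAlgebra
          (Ideal.span ((fun e : Fin n →₀ ℕ => Ideal.Quotient.mk (Ideal.span (Set.range Fs)) (monomial e (1 : k))) '' (A : Set _)))
          (Ideal.Quotient.mk (Ideal.span (Set.range Fs)) (monomial m (1 : k))))) [Q.IsPrime]
    (hX : ∀ i : Fin n, (X i : MvPolynomial (Fin n) k) ∈ Q.comap φ →
      IsSMulRegular (Localization.AtPrime (Q.comap φ) ⧸ (Ideal.span (Set.range gs)).map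
          (algebraMap (MvPolynomial (Fin n) k) (Localization.AtPrime (Q.comap φ))))
        (algebraMap (MvPolynomial (Fin n) k) (Localization.AtPrime (Q.comap φ)) (X i))) :
    Nonempty (Localization.AtPrime Q ≃+*
      Localization.AtPrime (Q.comap φ) ⧸ (Ideal.span (Set.range gs)).map
        (algebraMap (MvPolynomial (Fin n) k) (Localization.AtPrime (Q.comap φ)))) := by
  have hker : ∀ h : MvPolynomial (Fin n) k, h ∈ RingHom.ker φ ↔ aeval (fun i : Fin n => algebraMap (MvPolynomial (Fin n) k ⧸ Ideal.span (Set.range Fs))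
          (Localization.Away (Ideal.Quotient.mk (Ideal.span (Set.range Fs)) (monomial m (1 : k))))
          (Ideal.Quotient.mk (Ideal.span (Set.range Fs)) (monomial (a i) (1 : k))) *
          IsLocalization.Away.invSelf (Ideal.Quotient.mk (Ideal.span (Set.range Fs)) (monomial m (1 : k)))) h = 0 := fun h => by
    rw [RingHom.mem_ker, Subtype.ext_iff, hφ]
    rfl
  have hks := span_le_ker_and_sat_of_isPrime V hV m a hgen Fs gs d hθF hprime hXne φ hker
  exact nonempty_localization_ringEquiv_quotient φ hsurj (Ideal.span (Set.range gs)) hks.1 hks.2 Q hX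

end Chart

end CIChartPresentationLocal

/-! ## §2 `CIChartPresentationBridge` twin -/

namespace CIChartPresentationBridge

section Chart

variable {n : ℕ} {k : Type} [Field k]

variable (V : Matrix (Fin n) (Fin n) ℕ)
  (hV : IsUnit (V.map (Nat.cast : ℕ → ℤ)).det) (m : Fin n →₀ ℕ) (a : Fin n → (Fin n →₀ ℕ))
  (hgen : ∀ i : Fin n, (Finsupp.equivFunOnFinite.symm (V.mulVec ⇑(a i)) : Fin n →₀ ℕ) =
    Finsupp.equivFunOnFinite.symm (V.mulVec ⇑m) + Finsupp.single i 1)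
  (A : Finset (Fin n →₀ ℕ))
  {c : ℕ} (Fs gs : Fin c → MvPolynomial (Fin n) k) (d : Fin c → (Fin n →₀ ℕ))
  (hθF : ∀ i : Fin c, aeval (fun j : Fin n => ∏ l : Fin n, (X l : MvPolynomial (Fin n) k) ^ V l j) (Fs i) =
    monomial (d i) (1 : k) * gs i)

include hV hgen hθF in
/-- **`B_𝔔 ≃+* (k[Y]⧸(g))_{Q'}`, prime form** (NO `hunit`). [folklore] -/
theorem nonempty_localization_ringEquiv_quotientChart_of_isPrime (hprime : (Ideal.span (Set.range Fs)).IsPrime) (hXne : ∀ j : Fin n, Ideal.Quotient.mk (Ideal.span (Set.range Fs)) (X j) ≠ 0)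
    (φ : MvPolynomial (Fin n) k →+* ↥(blowupAlgebra
          (Ideal.span ((fun e : Fin n →₀ ℕ => Ideal.Quotient.mk (Ideal.span (Set.range Fs)) (monomial e (1 : k))) '' (A : Set _)))
          (Ideal.Quotient.mk (Ideal.span (Set.range Fs)) (monomial m (1 : k)))))
    (hsurj : Function.Surjective φ) (hφ : ∀ q : MvPolynomial (Fin n) k, (φ q).val = aeval (fun i : Fin n => algebraMap (MvPolynomial (Fin n) k ⧸ Ideal.span (Set.range Fs))
          (Localization.Away (Ideal.Quotient.mk (Ideal.span (Set.range Fs)) (monomial m (1 : k))))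
          (Ideal.Quotient.mk (Ideal.span (Set.range Fs)) (monomial (a i) (1 : k))) *
          IsLocalization.Away.invSelf (Ideal.Quotient.mk (Ideal.span (Set.range Fs)) (monomial m (1 : k)))) q)
    (𝔔 : Ideal ↥(blowupAlgebra
          (Ideal.span ((fun e : Fin n →₀ ℕ => Ideal.Quotient.mk (Ideal.span (Set.range Fs)) (monomial e (1 : k))) '' (A : Set _)))
          (Ideal.Quotient.mk (Ideal.span (Set.range Fs)) (monomial m (1 : k))))) [𝔔.IsPrime]
    (Q' : Ideal (MvPolynomial (Fin n) k ⧸ Ideal.span (Set.range gs))) [Q'.IsPrime]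
    (hQ' : Q'.comap (Ideal.Quotient.mk (Ideal.span (Set.range gs))) = 𝔔.comap φ)
    (hX : ∀ i : Fin n, (X i : MvPolynomial (Fin n) k) ∈ Q'.comap (Ideal.Quotient.mk (Ideal.span (Set.range gs))) →
      IsSMulRegular (Localization.AtPrime (Q'.comap (Ideal.Quotient.mk (Ideal.span (Set.range gs)))) ⧸
          (Ideal.span (Set.range gs)).map (algebraMap (MvPolynomial (Fin n) k)
            (Localization.AtPrime (Q'.comap (Ideal.Quotient.mk (Ideal.span (Set.range gs)))))))
        (algebraMap (MvPolynomial (Fin n) k)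
          (Localization.AtPrime (Q'.comap (Ideal.Quotient.mk (Ideal.span (Set.range gs))))) (X i))) :
    Nonempty (Localization.AtPrime 𝔔 ≃+* Localization.AtPrime Q') := by
  -- part 3 at a prime `P` EQUAL to `φ⁻¹𝔔` (subst), applied to `P := Q' ∩ k[Y]`
  have key : ∀ (P : Ideal (MvPolynomial (Fin n) k)) [P.IsPrime], P = 𝔔.comap φ →
      (∀ i : Fin n, (X i : MvPolynomial (Fin n) k) ∈ P →
        IsSMulRegular (Localization.AtPrime P ⧸ (Ideal.span (Set.range gs)).map
            (algebraMap (MvPolynomial (Fin n) k) (Localization.AtPrime P)))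
          (algebraMap (MvPolynomial (Fin n) k) (Localization.AtPrime P) (X i))) →
      Nonempty (Localization.AtPrime 𝔔 ≃+* Localization.AtPrime P ⧸ (Ideal.span (Set.range gs)).map
        (algebraMap (MvPolynomial (Fin n) k) (Localization.AtPrime P))) := by
    intro P _ hP hXP
    subst hP
    exact CIChartPresentationLocal.nonempty_localization_ringEquiv_of_isPrime V hV m a hgen A Fs gs d hθF hprime hXne φ hsurj hφ 𝔔 hXP
  obtain ⟨ε₁⟩ := key _ hQ' hX
  obtain ⟨ε₂⟩ := CIFedderAtMaximalIdeal.nonempty_quotLocalizationEquiv (MvPolynomial (Fin n) k) (Ideal.span (Set.range gs)) Q'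
  exact ⟨ε₁.trans ε₂⟩

end Chart

end CIChartPresentationBridge

/-! ## §3 `CIConeFiModel` twin -/

namespace CIConeFiModel

section Chart

variable (p : ℕ) {n : ℕ} {k : Type} [Field k]
  (V : Matrix (Fin n) (Fin n) ℕ)
  (hV : IsUnit (V.map (Nat.cast : ℕ → ℤ)).det) (m : Fin n →₀ ℕ) (a : Fin n → (Fin n →₀ ℕ))
  (hgen : ∀ i : Fin n, (Finsupp.equivFunOnFinite.symm (V.mulVec ⇑(a i)) : Fin n →₀ ℕ) =
    Finsupp.equivFunOnFinite.symm (V.mulVec ⇑m) + Finsupp.single i 1)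
  (A : Finset (Fin n →₀ ℕ)) (haA : ∀ i, a i ∈ A)
  (hge : ∀ e ∈ A, (Finsupp.equivFunOnFinite.symm (V.mulVec ⇑m) : Fin n →₀ ℕ) ≤
    Finsupp.equivFunOnFinite.symm (V.mulVec ⇑e))
  (J : Finset (Fin n)) (hprim : ∀ j ∈ J, ∃ N : ℕ, Finsupp.single j N ∈ A)
  {r : ℕ} (Fs gs : Fin r → MvPolynomial (Fin n) k) (d : Fin r → (Fin n →₀ ℕ))
  (hθF : ∀ l : Fin r, aeval (fun j : Fin n => ∏ l : Fin n, (X l : MvPolynomial (Fin n) k) ^ V l j) (Fs l) =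
    monomial (d l) (1 : k) * gs l)

include hV hgen haA hge hprim hθF in
/-- **The per-chart transport, prime form** (NO `hunit`): the clause at a maximal `𝔔 ∋ x̄^m` of the strict-transform chart from the naive-quotient clause `hon'`. [folklore] -/
theorem chartClause_of_quotientChartClause_of_isPrime (hprime : (Ideal.span (Set.range Fs)).IsPrime) (hXne : ∀ j : Fin n, Ideal.Quotient.mk (Ideal.span (Set.range Fs)) (X j) ≠ 0)
    (hon' : ∀ (Q' : Ideal (MvPolynomial (Fin n) k ⧸ Ideal.span (Set.range gs))) [Q'.IsMaximal],
      (∀ j ∈ J, Ideal.Quotient.mk (Ideal.span (Set.range gs)) (aeval (fun j : Fin n => ∏ l : Fin n, (X l : MvPolynomial (Fin n) k) ^ V l j) (X j : MvPolynomial (Fin n) k)) ∈ Q') →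
        (∀ i : Fin n, (X i : MvPolynomial (Fin n) k) ∈ Q'.comap (Ideal.Quotient.mk (Ideal.span (Set.range gs))) →
          IsSMulRegular (Localization.AtPrime (Q'.comap (Ideal.Quotient.mk (Ideal.span (Set.range gs)))) ⧸
              (Ideal.span (Set.range gs)).map (algebraMap (MvPolynomial (Fin n) k)
                (Localization.AtPrime (Q'.comap (Ideal.Quotient.mk (Ideal.span (Set.range gs)))))))
            (algebraMap (MvPolynomial (Fin n) k) (Localization.AtPrime (Q'.comap (Ideal.Quotient.mk (Ideal.span (Set.range gs))))) (X i))) ∧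
        ∀ dd : ℕ, ringKrullDim (Localization.AtPrime Q') = dd → ∀ s : Fin dd → Localization.AtPrime Q',
          (Ideal.span (Set.range s)).radical.IsMaximal →
            RingTheory.Sequence.IsWeaklyRegular (Localization.AtPrime Q') (List.ofFn s) ∧
            ∀ y : Localization.AtPrime Q', (∃ e : ℕ, y ^ p ^ e ∈ Ideal.span
              ((fun z : Localization.AtPrime Q' => z ^ p ^ e) ''
                (Ideal.span (Set.range s) : Set (Localization.AtPrime Q')))) → y ∈ Ideal.span (Set.range s))
    (𝔔 : Ideal ↥(blowupAlgebra (Ideal.span ((fun e : Fin n →₀ ℕ => Ideal.Quotient.mk (Ideal.span (Set.range Fs)) (monomial e (1 : k))) '' (A : Set _))) (Ideal.Quotient.mk (Ideal.span (Set.range Fs)) (monomial m (1 : k))))) [𝔔.IsMaximal]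
    (hu : algebraMap (MvPolynomial (Fin n) k ⧸ Ideal.span (Set.range Fs)) ↥(blowupAlgebra (Ideal.span ((fun e : Fin n →₀ ℕ => Ideal.Quotient.mk (Ideal.span (Set.range Fs)) (monomial e (1 : k))) '' (A : Set _))) (Ideal.Quotient.mk (Ideal.span (Set.range Fs)) (monomial m (1 : k)))) (Ideal.Quotient.mk (Ideal.span (Set.range Fs)) (monomial m (1 : k))) ∈ 𝔔) :
    ∀ dd : ℕ, ringKrullDim (Localization.AtPrime 𝔔) = dd → ∀ s : Fin dd → Localization.AtPrime 𝔔,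
      (Ideal.span (Set.range s)).radical.IsMaximal →
        RingTheory.Sequence.IsWeaklyRegular (Localization.AtPrime 𝔔) (List.ofFn s) ∧
        ∀ y : Localization.AtPrime 𝔔, (∃ e : ℕ, y ^ p ^ e ∈ Ideal.span
          ((fun z : Localization.AtPrime 𝔔 => z ^ p ^ e) ''
            (Ideal.span (Set.range s) : Set (Localization.AtPrime 𝔔)))) → y ∈ Ideal.span (Set.range s) := by
  classical
  -- the corestriction `φ` of the chart map and its kernel sandwich
  have hex := CIChartPresentationLocal.exists_corestriction V hV m a hgen A haA hge Fs
  let φ := hex.choose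
  have hsurj : Function.Surjective φ := hex.choose_spec.1
  have hφ : ∀ q : MvPolynomial (Fin n) k, (φ q).val = aeval (fun i : Fin n => algebraMap (MvPolynomial (Fin n) k ⧸ Ideal.span (Set.range Fs))
          (Localization.Away (Ideal.Quotient.mk (Ideal.span (Set.range Fs)) (monomial m (1 : k))))
          (Ideal.Quotient.mk (Ideal.span (Set.range Fs)) (monomial (a i) (1 : k))) *
          IsLocalization.Away.invSelf (Ideal.Quotient.mk (Ideal.span (Set.range Fs)) (monomial m (1 : k)))) q := hex.choose_spec.2
  have hker : ∀ h : MvPolynomial (Fin n) k, h ∈ RingHom.ker φ ↔ aeval (fun i : Fin n => algebraMap (MvPolynomial (Fin n) k ⧸ Ideal.span (Set.range Fs))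
          (Localization.Away (Ideal.Quotient.mk (Ideal.span (Set.range Fs)) (monomial m (1 : k))))
          (Ideal.Quotient.mk (Ideal.span (Set.range Fs)) (monomial (a i) (1 : k))) *
          IsLocalization.Away.invSelf (Ideal.Quotient.mk (Ideal.span (Set.range Fs)) (monomial m (1 : k)))) h = 0 := fun h => by
    rw [RingHom.mem_ker, Subtype.ext_iff, hφ]
    rfl
  have hks := CIChartPresentationLocal.span_le_ker_and_sat_of_isPrime V hV m a hgen Fs gs d hθF hprime hXne φ hker
  -- the maximal ideal `Q'` of `k[Y]/(g)` under `𝔔`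
  have hex' := CIChartPresentationBridge.exists_isMaximal_comap_eq φ hsurj (Ideal.span (Set.range gs)) hks.1 𝔔
  let Q' := hex'.choose
  haveI hQ'max : Q'.IsMaximal := hex'.choose_spec.1
  have hQ' : Q'.comap (Ideal.Quotient.mk (Ideal.span (Set.range gs))) = 𝔔.comap φ := hex'.choose_spec.2
  -- every `θ(X_j)` lies in `Q'`: `φ (θ X_j) = x̄ⱼ/1` and `x̄ⱼ^N ∈ I_A·R`, `x̄^m ∈ 𝔔`
  have hθQ' : ∀ j ∈ J, Ideal.Quotient.mk (Ideal.span (Set.range gs)) (aeval (fun j : Fin n => ∏ l : Fin n, (X l : MvPolynomial (Fin n) k) ^ V l j) (X j : MvPolynomial (Fin n) k)) ∈ Q' := by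
    intro j hjJ
    have hj : aeval (fun j : Fin n => ∏ l : Fin n, (X l : MvPolynomial (Fin n) k) ^ V l j) (X j : MvPolynomial (Fin n) k) ∈ Q'.comap (Ideal.Quotient.mk (Ideal.span (Set.range gs))) := by
      rw [hQ', Ideal.mem_comap]
      have hN := (hprim j hjJ).choose_spec
      have hval : φ (aeval (fun j : Fin n => ∏ l : Fin n, (X l : MvPolynomial (Fin n) k) ^ V l j) (X j : MvPolynomial (Fin n) k)) = algebraMap (MvPolynomial (Fin n) k ⧸ Ideal.span (Set.range Fs)) ↥(blowupAlgebra (Ideal.span ((fun e : Fin n →₀ ℕ => Ideal.Quotient.mk (Ideal.span (Set.range Fs)) (monomial e (1 : k))) '' (A : Set _))) (Ideal.Quotient.mk (Ideal.span (Set.range Fs)) (monomial m (1 : k)))) (Ideal.Quotient.mk (Ideal.span (Set.range Fs)) (X j)) := by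
        apply Subtype.ext
        rw [hφ, CIChartPresentationRange.psi_theta (Ideal.span (Set.range Fs)) V hV m a hgen (X j)]
        rfl
      rw [hval]
      refine algebraMap_mem_of_pow_mem _ _ 𝔔 hu (N := (hprim j hjJ).choose) ?_
      rw [← map_pow, X_pow_eq_monomial]
      exact Ideal.subset_span ⟨_, hN, rfl⟩
    exact hj
  -- binder and clause at `Q'`, then transport along `B_𝔔 ≃ (k[Y]/(g))_(Q')`
  have hX := (hon' Q' hθQ').1
  have hcl := (hon' Q' hθQ').2
  have hε := CIChartPresentationBridge.nonempty_localization_ringEquiv_quotientChart_of_isPrime V hV m a hgen A Fs gs d hθF hprime hXne φ hsurj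
    hφ 𝔔 Q' hQ' hX
  exact DegreeZeroDescent.inlineClause_of_ringEquiv p (L := Localization.AtPrime Q') (L' := Localization.AtPrime 𝔔)
    hε.some.symm hcl

end Chart

end CIConeFiModel

/-! ## §4 ★ `CICertificates` twin: the engine without `hunit` -/

namespace CICertificates

section Chart

variable (p : ℕ) {n : ℕ} (k : Type) [Field k]

/-- ★ **c.i.-CN CERTIFICATES, prime form** — `CICertificates.ciCertificates` VERBATIM with the binder `hunit` REMOVED (it is replaced inside by the primality of `(F)` and
`hXne`, both already hypotheses): cover inequality in the Rees algebra, `x̄^(m c) ≠ 0`, and the CM + Frobenius-closed clause at every maximal ideal of every chart over the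
centre, from the chart data and the naive-quotient clause `hon'`. [folklore; cite: StacksProject, Tag 0804] -/
theorem ciCertificates_of_isPrime (J : Finset (Fin n))
    (A : Finset (Fin n →₀ ℕ)) (hprim : ∀ j ∈ J, ∃ N : ℕ, Finsupp.single j N ∈ A)
    (t : ℕ) (m : Fin t → (Fin n →₀ ℕ))
    (hcov : ∀ a ∈ A, ∃ (c : Fin t) (K : ℕ), 1 ≤ K ∧ ∃ y ∈ (Ideal.span ((fun b : Fin n →₀ ℕ => (MvPolynomial.monomial b (1 : k) : MvPolynomial (Fin n) k)) '' (A : Set (Fin n →₀ ℕ)))) ^ (K - 1),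
      (MvPolynomial.monomial a (1 : k) : MvPolynomial (Fin n) k) ^ K = MvPolynomial.monomial (m c) 1 * y)
    (V : Fin t → Matrix (Fin n) (Fin n) ℕ) (hV : ∀ c, IsUnit ((V c).map (Nat.cast : ℕ → ℤ)).det)
    (a : Fin t → Fin n → (Fin n →₀ ℕ)) (haA : ∀ c i, a c i ∈ A)
    (hgen : ∀ (c : Fin t) (i : Fin n), (Finsupp.equivFunOnFinite.symm ((V c).mulVec ⇑(a c i)) : Fin n →₀ ℕ) =
      Finsupp.equivFunOnFinite.symm ((V c).mulVec ⇑(m c)) + Finsupp.single i 1)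
    (hge : ∀ (c : Fin t), ∀ e ∈ A, (Finsupp.equivFunOnFinite.symm ((V c).mulVec ⇑(m c)) : Fin n →₀ ℕ) ≤
      Finsupp.equivFunOnFinite.symm ((V c).mulVec ⇑e))
    {r : ℕ} (Fs : Fin r → MvPolynomial (Fin n) k) (hprime : (Ideal.span (Set.range Fs)).IsPrime)
    (hXne : ∀ v : Fin n, Ideal.Quotient.mk (Ideal.span (Set.range Fs)) (MvPolynomial.X v) ≠ 0)
    (gs : Fin t → Fin r → MvPolynomial (Fin n) k) (d : Fin t → Fin r → (Fin n →₀ ℕ))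
    (hθF : ∀ (c : Fin t) (l : Fin r), aeval (fun j : Fin n => ∏ i : Fin n, (X i : MvPolynomial (Fin n) k) ^ V c i j) (Fs l) =
      monomial (d c l) (1 : k) * gs c l)
    (hon' : ∀ (c : Fin t) (Q' : Ideal (MvPolynomial (Fin n) k ⧸ Ideal.span (Set.range (gs c)))) [Q'.IsMaximal],
      (∀ j ∈ J, Ideal.Quotient.mk (Ideal.span (Set.range (gs c)))
        (aeval (fun j : Fin n => ∏ i : Fin n, (X i : MvPolynomial (Fin n) k) ^ V c i j) (X j : MvPolynomial (Fin n) k)) ∈ Q') →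
        (∀ i : Fin n, (X i : MvPolynomial (Fin n) k) ∈ Q'.comap (Ideal.Quotient.mk (Ideal.span (Set.range (gs c)))) →
          IsSMulRegular (Localization.AtPrime (Q'.comap (Ideal.Quotient.mk (Ideal.span (Set.range (gs c))))) ⧸
              (Ideal.span (Set.range (gs c))).map (algebraMap (MvPolynomial (Fin n) k)
                (Localization.AtPrime (Q'.comap (Ideal.Quotient.mk (Ideal.span (Set.range (gs c))))))))
            (algebraMap (MvPolynomial (Fin n) k)
              (Localization.AtPrime (Q'.comap (Ideal.Quotient.mk (Ideal.span (Set.range (gs c)))))) (X i))) ∧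
        ∀ dd : ℕ, ringKrullDim (Localization.AtPrime Q') = dd → ∀ s : Fin dd → Localization.AtPrime Q',
          (Ideal.span (Set.range s)).radical.IsMaximal →
            RingTheory.Sequence.IsWeaklyRegular (Localization.AtPrime Q') (List.ofFn s) ∧
            ∀ y : Localization.AtPrime Q', (∃ e : ℕ, y ^ p ^ e ∈ Ideal.span
              ((fun z : Localization.AtPrime Q' => z ^ p ^ e) ''
                (Ideal.span (Set.range s) : Set (Localization.AtPrime Q')))) → y ∈ Ideal.span (Set.range s))
    (hv : ∀ c : Fin t, Ideal.Quotient.mk (Ideal.span (Set.range Fs)) (monomial (m c) (1 : k)) ∈ (Ideal.span ((fun e : Fin n →₀ ℕ => Ideal.Quotient.mk (Ideal.span (Set.range Fs)) (monomial e (1 : k))) '' (A : Set (Fin n →₀ ℕ))))) :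
    (HomogeneousIdeal.irrelevant (reesGrading (Ideal.span ((fun e : Fin n →₀ ℕ => Ideal.Quotient.mk (Ideal.span (Set.range Fs)) (monomial e (1 : k))) '' (A : Set (Fin n →₀ ℕ)))))).toIdeal ≤
        (Ideal.span (Set.range fun c : Fin t => reesT (I := (Ideal.span ((fun e : Fin n →₀ ℕ => Ideal.Quotient.mk (Ideal.span (Set.range Fs)) (monomial e (1 : k))) '' (A : Set (Fin n →₀ ℕ)))))
          (Ideal.Quotient.mk (Ideal.span (Set.range Fs)) (monomial (m c) (1 : k))) (hv c))).radical ∧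
      (∀ c : Fin t, Ideal.Quotient.mk (Ideal.span (Set.range Fs)) (monomial (m c) (1 : k)) ≠ 0) ∧
      ∀ (c : Fin t) (Q : Ideal ↥(blowupAlgebra (Ideal.span ((fun e : Fin n →₀ ℕ => Ideal.Quotient.mk (Ideal.span (Set.range Fs)) (monomial e (1 : k))) '' (A : Set (Fin n →₀ ℕ)))) (Ideal.Quotient.mk (Ideal.span (Set.range Fs)) (monomial (m c) (1 : k))))) [Q.IsMaximal],
        algebraMap (MvPolynomial (Fin n) k ⧸ Ideal.span (Set.range Fs)) ↥(blowupAlgebra (Ideal.span ((fun e : Fin n →₀ ℕ => Ideal.Quotient.mk (Ideal.span (Set.range Fs)) (monomial e (1 : k))) '' (A : Set (Fin n →₀ ℕ)))) (Ideal.Quotient.mk (Ideal.span (Set.range Fs)) (monomial (m c) (1 : k)))) (Ideal.Quotient.mk (Ideal.span (Set.range Fs)) (monomial (m c) (1 : k))) ∈ Q →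
        ∀ dd : ℕ, ringKrullDim (Localization.AtPrime Q) = dd → ∀ s : Fin dd → Localization.AtPrime Q,
          (Ideal.span (Set.range s)).radical.IsMaximal →
            RingTheory.Sequence.IsWeaklyRegular (Localization.AtPrime Q) (List.ofFn s) ∧
            ∀ y : Localization.AtPrime Q, (∃ e : ℕ, y ^ p ^ e ∈ Ideal.span
              ((fun z : Localization.AtPrime Q => z ^ p ^ e) ''
                (Ideal.span (Set.range s) : Set (Localization.AtPrime Q)))) → y ∈ Ideal.span (Set.range s) := by
  haveI := hprime
  refine ⟨?_, fun c => CIConeFiModelCore.mk_monomial_ne_zero (Ideal.span (Set.range Fs)) hXne (m c), fun c Q _ hu => ?_⟩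
  · -- THE COVER, read off the identities `(x^a)^K = x^(m c) · y`
    have hImap : (Ideal.span ((fun e : Fin n →₀ ℕ => Ideal.Quotient.mk (Ideal.span (Set.range Fs)) (monomial e (1 : k))) '' (A : Set (Fin n →₀ ℕ)))) =
        (Ideal.span ((fun b : Fin n →₀ ℕ => (MvPolynomial.monomial b (1 : k) : MvPolynomial (Fin n) k)) '' (A : Set (Fin n →₀ ℕ)))).map
          (Ideal.Quotient.mk (Ideal.span (Set.range Fs))) := by
      rw [Ideal.map_span, Set.image_image]
    refine ReesCoverOfPowers.stub_reesCoverOfPowers _ _ (Ideal.Quotient.mk (Ideal.span (Set.range Fs)) '' ((fun b : Fin n →₀ ℕ =>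
      (MvPolynomial.monomial b (1 : k) : MvPolynomial (Fin n) k)) '' (A : Set (Fin n →₀ ℕ)))) (by rw [hImap, Ideal.map_span]) t _ hv ?_
    rintro _ ⟨_, ⟨a', ha', rfl⟩, rfl⟩
    obtain ⟨c, K, hK, y, hy, hEq⟩ := hcov a' ha'
    refine ⟨c, K, hK, Ideal.Quotient.mk (Ideal.span (Set.range Fs)) y, ?_, ?_⟩
    · rw [hImap, ← Ideal.map_pow]
      exact Ideal.mem_map_of_mem _ hy
    · rw [← map_pow, hEq, map_mul]
  · exact CIConeFiModel.chartClause_of_quotientChartClause_of_isPrime p (V c) (hV c) (m c) (a c) (hgen c) A (haA c) (hge c) J hprim Fs (gs c)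
      (d c) (hθF c) hprime hXne (hon' c) Q hu

end Chart

end CICertificates

end Summit.ResolutionOfSingularities.ResolutionOfSingularities.Theorems.FInjectiveMacaulayfication

end
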